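import Summits.NavierStokesRegularity.NavierStokesRegularity.Theses.AxisymmetricExtremality
import Summits.NavierStokesRegularity.NavierStokesRegularity.Theorems.AxisymmetricExtremalityAxisymmetricKatoGlobalNoSwirlStratum
import Literature.Analysis.FluidPDE.AxisymmetricReflection
import HarnessLib

/-!
# Strategist s20-g28 (family `s`, independent census) — typed census objects for the crux
`AxisymmetricExtremality.AxisymmetricKatoGlobal` (stmt-NavierStokesRegularity-15453)

Sorry-free bookkeeping for `STRATEGY-CENSUS-s20.md` (§1 summit-down, §7 recommendation).
Nothing here is a line or a stub; nothing here proves the crux.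

* §1 W0 — `NoAxisymMinimalBlowupDatum`: the EXACT residual of the route's deciding theorem
  `closes` (it consumes AX_H only at an axisymmetric Rusin–Šverák minimal blow-up datum):
  `w0_of_crux` (crux ⇒ W0, one line) and `closes_of_w0` (W0 replaces the crux in `closes`).
  W0 is formally weaker than the crux but carries no tool the crux lacks (census §1).
* §1 W2 / §7 — `NoO2MinimalBlowupDatum`: no minimal blow-up datum is axisymmetric AND
  equivariant under the meridian reflection `reflY`; this is a THEOREM of the tree
  (`noO2MinimalBlowupDatum_holds`: `IsAxisymmetric.hasNoSwirl_of_reflY_eq` +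
  `hasGlobalKatoSolution_of_isAxisymmetric_hasNoSwirl_viscosity`, i.e. Ukhovskii–Yudovich /
  Ladyzhenskaya 1968 in Kato's class). Hence the ROUTE-LEVEL re-glue `closes_dihedral`:
  if the Smith-theory crux `MinimalDatumPFold` is upgraded from the cyclic groups `C_p` to the
  dihedral groups `D_p = ⟨R_{2π/p}, σ⟩` (`MinimalDatumDihedral`, which implies `MinimalDatumPFold`,
  `minimalDatumPFold_of_dihedral`) and the PROVED compactness item `PFoldToAxisymmetric` is re-run
  with one more group element (`DihedralToO2`, M-sized), then `NavierStokesRegularity` follows with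
  NO appeal to AX_H. This does not prove the crux; it removes it from the cone. Outside this seat's
  write set (`no_new_routes`); recommended to the tenure planner.
-/

noncomputable section

open MeasureTheory
open Literature.Analysis.FluidPDE
open Summit.NavierStokesRegularity.NavierStokesRegularity.Theses.AxisymmetricExtremality

namespace Summit.NavierStokesRegularity.NavierStokesRegularity.Cruxes.AxisymmetricKatoGlobal.StrategistS20g28

local notation "ℝ³" => EuclideanSpace ℝ (Fin 3)
local notation "ℂ³" => EuclideanSpace ℂ (Fin 3)

/-! ## §1 W0 — the exact residual of `closes` -/

/-- W0: no Rusin–Šverák `Ḣ^{1/2}`-minimal blow-up datum is axisymmetric (about the `x 2`-axis;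
WLOG by the rotation/translation covariance of `M`). The only instance of the crux that the
route's deciding theorem `closes` consumes. -/
def NoAxisymMinimalBlowupDatum : Prop :=
  ∀ ν : ℝ, 0 < ν → ∀ (u₀ : ℝ³ → ℝ³) (g : Literature.Analysis.FunctionSpaces.HomSobolev ℝ³ ℂ³ (1 / 2 : ℝ)),
    IsMinimalBlowupDatum ν u₀ g → IsAxisymmetric u₀ → False

/-- crux ⇒ W0 (one line: a minimal blow-up datum has no global Kato solution). -/
theorem w0_of_crux (h : AxisymmetricKatoGlobal) : NoAxisymMinimalBlowupDatum := by
  intro ν hν u₀ g hmin hax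
  obtain ⟨hL3, hrep, hdiv, -, hnot⟩ := hmin
  exact hnot (h ν hν u₀ g hL3 hrep hdiv (fun θ x => hax θ x))

/-- W0 replaces the crux in the deciding theorem: `MinimalDatumPFold → PFoldToAxisymmetric → W0 →
NavierStokesRegularity` (same pure-logic proof as the route's `closes`). -/
theorem closes_of_w0 (h₂ : MinimalDatumPFold) (h₄ : PFoldToAxisymmetric)
    (h₀ : NoAxisymMinimalBlowupDatum) : NavierStokesRegularity := by
  show Literature.NS.NavierStokesExistenceSmoothR3
  intro ν hν u₀ hsm hdiv hdec
  by_contra hno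
  obtain ⟨u₁, g, hmin, hax⟩ := h₄ ν hν (h₂ ν hν ⟨u₀, hsm, hdiv, hdec, hno⟩)
  exact h₀ ν hν u₁ g hmin (fun θ x => hax θ x)

/-! ## §1 W2 / §7 — the O(2) stratum is a theorem; the dihedral re-glue of the route -/

/-- Equivariance under the meridian reflection `σ (x₀,x₁,x₂) = (x₀,−x₁,x₂)`. Together with
axisymmetry this is `O(2)`-equivariance, i.e. axisymmetric WITHOUT swirl
(`IsAxisymmetric.hasNoSwirl_iff_reflY`; Gallay–Šverák 2015 §1; Majda–Bertozzi §2.3.3). -/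
def IsMirrorSymmetric (u₀ : ℝ³ → ℝ³) : Prop :=
  ∀ x, u₀ (reflY x) = reflY (u₀ x)

/-- `p`-fold rotational equivariance about the `x 2`-axis, as written out in `MinimalDatumPFold`
(`rotZ` unfolds to the route file's `WithLp.toLp 2 ![…]` form, rfl). -/
def IsPFoldSymmetric (p : ℕ) (u₀ : ℝ³ → ℝ³) : Prop :=
  ∀ x, u₀ (rotZ (2 * Real.pi / p) x) = rotZ (2 * Real.pi / p) (u₀ x)

/-- W2: no minimal blow-up datum is `O(2)`-symmetric (axisymmetric and mirror-equivariant). -/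
def NoO2MinimalBlowupDatum : Prop :=
  ∀ ν : ℝ, 0 < ν → ∀ (u₀ : ℝ³ → ℝ³) (g : Literature.Analysis.FunctionSpaces.HomSobolev ℝ³ ℂ³ (1 / 2 : ℝ)),
    IsMinimalBlowupDatum ν u₀ g → IsAxisymmetric u₀ → IsMirrorSymmetric u₀ → False

/-- **W2 is a theorem of the tree** (every `ν > 0`): mirror-equivariant axisymmetric fields have no
swirl (`IsAxisymmetric.hasNoSwirl_of_reflY_eq`), and swirl-free axisymmetric weakly divergence-free
`L³` data have `T_max = ∞` (`hasGlobalKatoSolution_of_isAxisymmetric_hasNoSwirl_viscosity`),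
contradicting the minimality clause `¬ HasGlobalKatoSolution`. -/
theorem noO2MinimalBlowupDatum_holds : NoO2MinimalBlowupDatum := by
  intro ν hν u₀ g hmin hax hσ
  obtain ⟨hL3, -, hdiv, -, hnot⟩ := hmin
  exact hnot
    (Summit.NavierStokesRegularity.NavierStokesRegularity.Theorems.AxisymmetricKatoGlobal.NoSwirlStratum.hasGlobalKatoSolution_of_isAxisymmetric_hasNoSwirl_viscosity
      hν hL3 hdiv hax (hax.hasNoSwirl_of_reflY_eq hσ))

/-- The Clay-failure hypothesis of `MinimalDatumPFold` at viscosity `ν` (verbatim shape). -/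
def ClayFailureAt (ν : ℝ) : Prop :=
  ∃ v₀ : ℝ³ → ℝ³, ContDiff ℝ (⊤ : ℕ∞) v₀ ∧ NSWave0.IsDivFree v₀ ∧ HasRapidSpatialDecay v₀ ∧
    ¬ ∃ (u : ℝ → ℝ³ → ℝ³) (p : ℝ → ℝ³ → ℝ), IsSmoothOnHalfSpace u ∧ IsSmoothOnHalfSpace p ∧
      IsNavierStokesSolution ν 0 v₀ u p ∧ HasBoundedEnergy u

/-- DIHEDRAL upgrade of the route's rank-2 crux `MinimalDatumPFold`: under Clay failure at `ν`,
for every `N` there are `p ≥ max(N,2)` and a minimal blow-up datum equivariant under the dihedral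
group `D_p = ⟨R_{2π/p}, σ⟩` (not only the cyclic `C_p`). Same Smith-theory mechanism on
`M̂ = M/Sim`, applied to the 2-groups `D_{2^k}` (P. A. Smith / Allday–Puppe for finite `p`-groups,
`p = 2`); same why-it-might-fail as `MinimalDatumPFold` (no `F₂`-acyclicity of `M̂`). NOT filed
(route level). -/
def MinimalDatumDihedral : Prop :=
  ∀ ν : ℝ, 0 < ν → ClayFailureAt ν → ∀ N : ℕ, ∃ p : ℕ, N ≤ p ∧ 2 ≤ p ∧
    ∃ (u₀ : ℝ³ → ℝ³) (g : Literature.Analysis.FunctionSpaces.HomSobolev ℝ³ ℂ³ (1 / 2 : ℝ)),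
      IsMinimalBlowupDatum ν u₀ g ∧ IsPFoldSymmetric p u₀ ∧ IsMirrorSymmetric u₀

/-- The dihedral analogue of the PROVED item `PFoldToAxisymmetric` (Rusin–Šverák compactness mod
Sim, pass to an `Ḣ^{1/2}` limit, limit invariant under the closure of `⋃ D_{p_j} = O(2)` about a
limiting axis and mirror): M-sized, same proof plus one convergent sequence of mirror planes. -/
def DihedralToO2 : Prop :=
  ∀ ν : ℝ, 0 < ν →
    (∀ N : ℕ, ∃ p : ℕ, N ≤ p ∧ 2 ≤ p ∧
      ∃ (u₀ : ℝ³ → ℝ³) (g : Literature.Analysis.FunctionSpaces.HomSobolev ℝ³ ℂ³ (1 / 2 : ℝ)),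
        IsMinimalBlowupDatum ν u₀ g ∧ IsPFoldSymmetric p u₀ ∧ IsMirrorSymmetric u₀) →
    ∃ (u₀ : ℝ³ → ℝ³) (g : Literature.Analysis.FunctionSpaces.HomSobolev ℝ³ ℂ³ (1 / 2 : ℝ)),
      IsMinimalBlowupDatum ν u₀ g ∧ IsAxisymmetric u₀ ∧ IsMirrorSymmetric u₀

/-- The dihedral crux is a strengthening of the route's `MinimalDatumPFold` (drop the mirror). -/
theorem minimalDatumPFold_of_dihedral (hD : MinimalDatumDihedral) : MinimalDatumPFold := by
  intro ν hν hfail N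
  obtain ⟨p, hNp, h2p, u₀, g, hmin, hp, -⟩ := hD ν hν hfail N
  exact ⟨p, hNp, h2p, u₀, g, hmin, fun x => hp x⟩

/-- **Route-level re-glue without AX_H**: `MinimalDatumDihedral → DihedralToO2 →
NavierStokesRegularity`, the contradiction being supplied by the tree theorem
`noO2MinimalBlowupDatum_holds` instead of the crux `AxisymmetricKatoGlobal`. -/
theorem closes_dihedral (hD : MinimalDatumDihedral) (hO : DihedralToO2) : NavierStokesRegularity := by
  show Literature.NS.NavierStokesExistenceSmoothR3
  intro ν hν u₀ hsm hdiv hdec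
  by_contra hno
  obtain ⟨u₁, g, hmin, hax, hσ⟩ := hO ν hν (hD ν hν ⟨u₀, hsm, hdiv, hdec, hno⟩)
  exact noO2MinimalBlowupDatum_holds ν hν u₁ g hmin hax hσ

end Summit.NavierStokesRegularity.NavierStokesRegularity.Cruxes.AxisymmetricKatoGlobal.StrategistS20g28

end
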